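import Literature.NumberTheory.IwasawaTheory.Greenberg2016.ShaTwoLevels
import Literature.NumberTheory.IwasawaTheory.Greenberg2016.DualSelmerCokernelTorsion
import HarnessLib

/-!
# Greenberg 2010 (6)/LEO: `Ш¹(K, Σ, T*)` is `Λ`-torsion, from a tower of restricted Ш-dualities
# (step (γ) of Prop. 3.2.1; the Ш-duality tower is a HYPOTHESIS; definitions with bodies + theorems)

Topic `NumberTheory/IwasawaTheory/Greenberg2016`; namespace
`Literature.NumberTheory.IwasawaTheory.Greenberg2016`.  Definitions WITH BODIES and theorems; no named
fact, no `sorry`, no instance, no notation.  Lane «SUR-Λ» of cell `bsd-eis` (road memo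
`SUR-LAMBDA-ROAD-w5g9.md` §2 ★(γ) / §8, brick C7b part 2), `--supports stmt-BirchSwinnertonDyer-19032`.

MATHEMATICS (R. Greenberg, Kyoto J. Math. 50 (2010), §2.1 (6) p. 7 and proof of Prop. 3.2.1 p. 15:
"LEO(D) implies that `Ш¹(K, Σ, T*)` is a torsion `Λ`-module"): the `Λ`-adic Ш-pairing
`Ш²(K, Σ, 𝐃) × Ш¹(K, Σ, T*) → ℚ_p/ℤ_p`, non-degenerate on the right and `Λ`-balanced, embeds
`Ш¹(K, Σ, T*)` into the Pontryagin dual of `Ш²(K, Σ, 𝐃)`; if `Ш²(K, Σ, 𝐃)` is COTORSION (`LEO`), that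
dual is `Λ`-torsion, so every `y ∈ Ш¹(K, Σ, T*)` is killed by some `θ ∈ Λ⁰`.  Here the pairing is
ASSEMBLED FROM THE FINITE LEVELS of a tower `N k` (Greenberg side `ρ_k := ρ.subrepresentation (N k) _`,
`Ш²_k := sha2 S ρ_k`; dual side the layers `E.layerDualRep k = Hom(D_k, μ_{p^k})` of a `TorsionLayers`
structure `E` with `E.N k = (N k).restrictScalars ℤ`-compatible duals, level sets
`Sh1 k ≤ H¹(Γ_K, Hom(D_k, μ_{p^k}))`), and the finite-level restricted Ш-dualities
`b k : Ш²_k × Sh1 k → ℚ/ℤ` are a HYPOTHESIS in tower form — (D-a) right non-degeneracy, (D-b₁)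
naturality along `(N k ⊆ N m, res)`, (D-b₂) `Λ`-balance `⟨r x, z⟩ = ⟨x, r̂_k z⟩`, plus the stability of
the `Sh1 k` under `res` and `r̂_k` — to be discharged by the «PT-Ш-S» lane (Milne ADT I 4.10 (a) for
`G_Σ`, natural) or typed as a named fact (road memo §8).  Results:

* `Hmap_subtype_mem_sha2`, `Hmap_inclusion_mem_sha2` (`h_k`, transitions preserve local triviality);
* **`shaFunctional … y hy : ↥(sha2 S ρ) →+ ℚ/ℤ`**, `x ↦ b k x_k y_k` through any level lift
  (`ShaTwoLevels.exists_level_sha2_lift`; independence of the lift = (D-b₁) + agree-deeper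
  `ContinuousRep.exists_cohomologyMap_eq_eq_two`; level formula `shaFunctional_apply_Hmap`);
* `shaFunctional_dualEndHom` — `Λ`-balance `Ψ(r̂ y)(x) = Ψ(y)(r x)` ((D-b₂) + the tree's
  `cohomologyMap_projHom_dualEndHom`);
* `eq_zero_of_shaFunctional_eq_zero` — `Ψ(y) = 0 → y = 0` ((D-a) levelwise +
  `DiscreteInvSystem.toCohomologyLimit₁_injective`);
* **`exists_nonZeroDivisor_dualEndHom_eq_zero_of_LEO`** — (γ): `LEO S ρ` (= `IsCotorsion Λ ↥(sha2 S ρ)`)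
  ⇒ `∃ r ∈ Λ⁰, H¹(r̂) y = 0` for every `y` with all `y_k ∈ Sh1 k` (`IsCotorsion` on the datum
  `(CharacterModule ↥(sha2 S ρ), id)`).

HONESTY: no Poitou–Tate duality, no case of Greenberg's propositions and nothing about BSD is proved
here.  AI formalisation, weaker than expert review; the statements are established only by the kernel check.

## References
* R. Greenberg, *Surjectivity of the global-to-local map defining a Selmer group*, Kyoto J. Math.
  50 (2010) 853–888, §2.1 (6) p. 7, proof of Prop. 3.2.1 p. 15. [Greenberg2010]
* J. S. Milne, *Arithmetic Duality Theorems*, 2nd ed. (2006), I Thm. 4.10 (a). [MilneADT2006]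
-/

noncomputable section

open scoped Classical
open Function CategoryTheory NumberField IsDedekindDomain Field
open _root_.TopRep _root_.ContRepresentation _root_.ContinuousCohomology
open Literature.NumberTheory.GaloisRepresentations
open Literature.NumberTheory.GaloisRepresentations.DiscreteGaloisModule
open Literature.NumberTheory.GaloisRepresentations.DiscreteGaloisModule.TorsionLayers

namespace Literature.NumberTheory.IwasawaTheory.Greenberg2016

variable {K : Type} [Field K] [NumberField K] {S : Set (HeightOneSpectrum (𝓞 K))}
  {Λ : Type} [CommRing Λ] [TopologicalSpace Λ]
  {D : Type} [AddCommGroup D] [Module Λ D] [TopologicalSpace D] [DiscreteTopology D]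
  [ContinuousSMul Λ D]
  {ρ : ContinuousRep (GaloisGroupUnramifiedOutside K S) Λ D}
  {N : ℕ → Submodule Λ D}
  {hN : ∀ (k : ℕ) (g : GaloisGroupUnramifiedOutside K S), N k ≤ (N k).comap (ρ g)}
  {p : ℕ} {E : (toGaloisModule S ρ).TorsionLayers p}

/-! ### §1. `h_k` and the transitions preserve `Ш²` -/

variable (hN) in
/-- `h_k (Ш²_k) ≤ Ш²(K, Σ, 𝐃)`: localisation commutes with `h_k`. [cite: Greenberg2010, §2.2 p. 6] -/
theorem Hmap_subtype_mem_sha2 {k : ℕ} {xk : (ρ.subrepresentation (N k) (hN k)).H 2}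
    (hxk : xk ∈ sha2 S (ρ.subrepresentation (N k) (hN k))) :
    Hmap (ρ.subrepresentation (N k) (hN k)) ρ (N k).subtypeL (fun _ _ ↦ rfl) 2 xk ∈ sha2 S ρ := by
  rw [mem_sha2_iff] at hxk ⊢
  intro v
  rw [loc_Hmap_subtype_comm, hxk v, map_zero]

variable (hN) in
/-- The transitions `Ш²_k → Ш²_m` (`k ≤ m`). [cite: Greenberg2010, §2.2 p. 6] -/
theorem Hmap_inclusion_mem_sha2 (hmono : Monotone N) {k m : ℕ} (h : k ≤ m)
    {xk : (ρ.subrepresentation (N k) (hN k)).H 2} (hxk : xk ∈ sha2 S (ρ.subrepresentation (N k) (hN k))) :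
    Hmap (ρ.subrepresentation (N k) (hN k)) (ρ.subrepresentation (N m) (hN m))
      ⟨Submodule.inclusion (hmono h), continuous_of_discreteTopology⟩ (fun _ _ ↦ rfl) 2 xk ∈
      sha2 S (ρ.subrepresentation (N m) (hN m)) := by
  rw [mem_sha2_iff] at hxk ⊢
  intro v
  rw [loc_Hmap_inclusion_comm S ρ N hN hmono h, hxk v, map_zero]

/-! ### §2. The tower of Ш-dualities (hypothesis shape) and the functional `x ↦ b k x_k y_k` -/

/-- **A tower of restricted Ш-dualities** for the levels `(Ш²_k, Sh1 k)`: pairings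
`b k : Ш²(K, Σ, D_k) × Sh1 k → ℚ/ℤ` that are natural along the transitions (`N k ⊆ N m` on the
`𝐃`-side, restriction `Hom(D_m, μ) → Hom(D_k, μ)` on the dual side) — the levelwise content of Milne
ADT I Thm. 4.10 (a) for `G_Σ` with its functoriality (road memo §8 (D-b₁)); `Sh1 k` is stable under the
dual transitions. A `Prop`-valued predicate (hypothesis of this file), not a named fact.
[cite: MilneADT2006, Ch. I, Thm. 4.10(a)] [cite: Greenberg2010, §2.1 (6) p. 7] -/
structure IsShaDualityTower (hmono : Monotone N) (Sh1 : ∀ k, AddSubgroup (galoisCohomology (E.layerDualRep k) 1))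
    (b : ∀ k, ↥(sha2 S (ρ.subrepresentation (N k) (hN k))) →+ ↥(Sh1 k) →+ AddCircle (1 : ℚ)) : Prop where
  /-- the dual transitions preserve the level sets -/
  red_mem : ∀ {k m : ℕ} (h : k ≤ m) (z : ↥(Sh1 m)),
    cohomologyMap (E.dualSystem.redHom h) 1 (z : galoisCohomology (E.layerDualRep m) 1) ∈ Sh1 k
  /-- naturality: `⟨(N k ⊆ N m)_* x, z⟩_m = ⟨x, res z⟩_k` -/
  natural : ∀ {k m : ℕ} (h : k ≤ m) (x : ↥(sha2 S (ρ.subrepresentation (N k) (hN k)))) (z : ↥(Sh1 m)),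
    b m ⟨_, Hmap_inclusion_mem_sha2 hN hmono h x.2⟩ z =
      b k x ⟨cohomologyMap (E.dualSystem.redHom h) 1 (z : galoisCohomology (E.layerDualRep m) 1),
        red_mem h z⟩

variable {hmono : Monotone N} {Sh1 : ∀ k, AddSubgroup (galoisCohomology (E.layerDualRep k) 1)}
  {b : ∀ k, ↥(sha2 S (ρ.subrepresentation (N k) (hN k))) →+ ↥(Sh1 k) →+ AddCircle (1 : ℚ)}

/-- **Independence of the level lift**: two locally trivial level lifts of the same class of
`Ш²(K, Σ, 𝐃)` pair identically with the components of `y` (agree-deeper for the lifts, then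
naturality (D-b₁) and the compatibility of the `y_k`). [cite: Greenberg2010, §2.1 (6) p. 7] -/
theorem shaPairing_level_indep (hT : IsShaDualityTower (E := E) hmono Sh1 b)
    (hex : ∀ d : D, ∃ k, d ∈ N k) (y : continuousCohomology 1 E.dualSystem.limitRep.toTopRep)
    (hy : ∀ k, cohomologyMap (E.dualSystem.projHom k) 1 y ∈ Sh1 k) {k k' : ℕ}
    (xk : (ρ.subrepresentation (N k) (hN k)).H 2) (hxk : xk ∈ sha2 S (ρ.subrepresentation (N k) (hN k)))
    (xk' : (ρ.subrepresentation (N k') (hN k')).H 2) (hxk' : xk' ∈ sha2 S (ρ.subrepresentation (N k') (hN k')))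
    (h : Hmap (ρ.subrepresentation (N k) (hN k)) ρ (N k).subtypeL (fun _ _ ↦ rfl) 2 xk =
      Hmap (ρ.subrepresentation (N k') (hN k')) ρ (N k').subtypeL (fun _ _ ↦ rfl) 2 xk') :
    b k ⟨xk, hxk⟩ ⟨_, hy k⟩ = b k' ⟨xk', hxk'⟩ ⟨_, hy k'⟩ := by
  -- agree at a common level `j`, then at the ℕ-level `m := max j (max k k')`
  obtain ⟨j, hkj, hk'j, hj⟩ := ρ.exists_cohomologyMap_eq_eq_two N hN hmono.directed_le hex xk xk'
    (TopRep.ofHom ⟨(N k).subtypeL, fun g ↦ by ext; rfl⟩) (fun _ ↦ rfl)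
    (TopRep.ofHom ⟨(N k').subtypeL, fun g ↦ by ext; rfl⟩) (fun _ ↦ rfl) h
  let m : ℕ := max j (max k k')
  have hkm : k ≤ m := (le_max_left k k').trans (le_max_right _ _)
  have hk'm : k' ≤ m := (le_max_right k k').trans (le_max_right _ _)
  have hjm : N j ≤ N m := hmono (le_max_left _ _)
  have hj' := hj (TopRep.ofHom ⟨⟨Submodule.inclusion hkj, continuous_of_discreteTopology⟩, fun g ↦ by ext; rfl⟩)
    (TopRep.ofHom ⟨⟨Submodule.inclusion hk'j, continuous_of_discreteTopology⟩, fun g ↦ by ext; rfl⟩)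
    (fun _ ↦ rfl) (fun _ ↦ rfl)
  -- `incl_{k→m} xk = incl_{k'→m} xk'`
  have hm : Hmap (ρ.subrepresentation (N k) (hN k)) (ρ.subrepresentation (N m) (hN m))
        ⟨Submodule.inclusion (hmono hkm), continuous_of_discreteTopology⟩ (fun _ _ ↦ rfl) 2 xk =
      Hmap (ρ.subrepresentation (N k') (hN k')) (ρ.subrepresentation (N m) (hN m))
        ⟨Submodule.inclusion (hmono hk'm), continuous_of_discreteTopology⟩ (fun _ _ ↦ rfl) 2 xk' := by
    rw [← Hmap_inclusion_Hmap_inclusion S ρ N hN hkj hjm 2 (Or.inr rfl) xk,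
      ← Hmap_inclusion_Hmap_inclusion S ρ N hN hk'j hjm 2 (Or.inr rfl) xk']
    exact congrArg _ hj'
  -- naturality on both sides
  have e1 := hT.natural hkm ⟨xk, hxk⟩ ⟨_, hy m⟩
  have e2 := hT.natural hk'm ⟨xk', hxk'⟩ ⟨_, hy m⟩
  -- compatibility of the components `y_k` (the tree's `cohomologyMap_redHom_projHom`)
  have c1 : cohomologyMap (E.dualSystem.redHom hkm) 1 (cohomologyMap (E.dualSystem.projHom m) 1 y) =
      cohomologyMap (E.dualSystem.projHom k) 1 y := (E.dualSystem.toCohomologyLimit₁ y).2 hkm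
  have c2 : cohomologyMap (E.dualSystem.redHom hk'm) 1 (cohomologyMap (E.dualSystem.projHom m) 1 y) =
      cohomologyMap (E.dualSystem.projHom k') 1 y := (E.dualSystem.toCohomologyLimit₁ y).2 hk'm
  simp only [c1, c2] at e1 e2
  rw [← e1, ← e2]
  exact congrArg (fun t : ↥(sha2 S (ρ.subrepresentation (N m) (hN m))) => b m t ⟨_, hy m⟩)
    (Subtype.ext hm)

variable (hN E b) in
/-- The functional `x ↦ b k x_k y_k` of `y` on `Ш²(K, Σ, 𝐃)` as a bare function (level and lift chosen
by `exists_level_sha2_lift`). [cite: Greenberg2010, §2.1 (6) p. 7] -/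
def shaFunctionalFun [Finite (SigmaPlace S)] (hmono : Monotone N) (hex : ∀ d : D, ∃ k, d ∈ N k)
    (y : continuousCohomology 1 E.dualSystem.limitRep.toTopRep)
    (hy : ∀ k, cohomologyMap (E.dualSystem.projHom k) 1 y ∈ Sh1 k) (x : ↥(sha2 S ρ)) :
    AddCircle (1 : ℚ) :=
  b _ ⟨_, (exists_level_sha2_lift S ρ N hN hmono hex x.1 x.2).choose_spec.choose_spec.1⟩ ⟨_, hy _⟩

/-- **Level formula**: `Ψ(y)(h_k x_k) = b k x_k y_k` for any locally trivial level lift.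
[cite: Greenberg2010, §2.1 (6) p. 7] -/
theorem shaFunctionalFun_Hmap [Finite (SigmaPlace S)] (hT : IsShaDualityTower (E := E) hmono Sh1 b)
    (hex : ∀ d : D, ∃ k, d ∈ N k) (y : continuousCohomology 1 E.dualSystem.limitRep.toTopRep)
    (hy : ∀ k, cohomologyMap (E.dualSystem.projHom k) 1 y ∈ Sh1 k) {k : ℕ}
    (xk : (ρ.subrepresentation (N k) (hN k)).H 2) (hxk : xk ∈ sha2 S (ρ.subrepresentation (N k) (hN k))) :
    shaFunctionalFun hN E b hmono hex y hy
        ⟨Hmap (ρ.subrepresentation (N k) (hN k)) ρ (N k).subtypeL (fun _ _ ↦ rfl) 2 xk,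
          Hmap_subtype_mem_sha2 hN hxk⟩ =
      b k ⟨xk, hxk⟩ ⟨_, hy k⟩ :=
  shaPairing_level_indep hT hex y hy _ _ xk hxk
    (exists_level_sha2_lift S ρ N hN hmono hex
      (Hmap (ρ.subrepresentation (N k) (hN k)) ρ (N k).subtypeL (fun _ _ ↦ rfl) 2 xk)
      (Hmap_subtype_mem_sha2 hN hxk)).choose_spec.choose_spec.2

variable (hN E b) in
/-- **`Ψ(y) : Ш²(K, Σ, 𝐃) →+ ℚ/ℤ`, `x ↦ b k x_k y_k`** — Greenberg's pairing (6) read in the dual of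
`Ш²(K, Σ, 𝐃)`, additive in `x` (two classes come from a common level). [cite: Greenberg2010, §2.1 (6) p. 7] -/
def shaFunctional [Finite (SigmaPlace S)] (hT : IsShaDualityTower (E := E) hmono Sh1 b)
    (hex : ∀ d : D, ∃ k, d ∈ N k) (y : continuousCohomology 1 E.dualSystem.limitRep.toTopRep)
    (hy : ∀ k, cohomologyMap (E.dualSystem.projHom k) 1 y ∈ Sh1 k) :
    CharacterModule ↥(sha2 S ρ) where
  toFun := shaFunctionalFun hN E b hmono hex y hy
  map_zero' := by
    have h := shaFunctionalFun_Hmap hT hex y hy (k := 0) 0 (Submodule.zero_mem _)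
    have e0 : (0 : ↥(sha2 S ρ)) = ⟨Hmap (ρ.subrepresentation (N 0) (hN 0)) ρ (N 0).subtypeL
        (fun _ _ ↦ rfl) 2 0, Hmap_subtype_mem_sha2 hN (Submodule.zero_mem _)⟩ :=
      Subtype.ext (map_zero _).symm
    rw [e0, h, show (⟨0, Submodule.zero_mem _⟩ : ↥(sha2 S (ρ.subrepresentation (N 0) (hN 0)))) = 0
      from rfl, map_zero, AddMonoidHom.zero_apply]
  map_add' x x' := by
    obtain ⟨k, xk, hxk, hx⟩ := exists_level_sha2_lift S ρ N hN hmono hex x.1 x.2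
    obtain ⟨k', xk', hxk', hx'⟩ := exists_level_sha2_lift S ρ N hN hmono hex x'.1 x'.2
    -- common level
    let m : ℕ := max k k'
    set z := Hmap (ρ.subrepresentation (N k) (hN k)) (ρ.subrepresentation (N m) (hN m))
        ⟨Submodule.inclusion (hmono (le_max_left k k')), continuous_of_discreteTopology⟩ (fun _ _ ↦ rfl) 2 xk
      with hz
    set z' := Hmap (ρ.subrepresentation (N k') (hN k')) (ρ.subrepresentation (N m) (hN m))
        ⟨Submodule.inclusion (hmono (le_max_right k k')), continuous_of_discreteTopology⟩ (fun _ _ ↦ rfl) 2 xk'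
      with hz'
    have hzS := Hmap_inclusion_mem_sha2 hN hmono (le_max_left k k') hxk
    have hz'S := Hmap_inclusion_mem_sha2 hN hmono (le_max_right k k') hxk'
    have hxz : (x : ρ.H 2) = Hmap (ρ.subrepresentation (N m) (hN m)) ρ (N m).subtypeL (fun _ _ ↦ rfl) 2 z := by
      rw [hz, Hmap_subtype_Hmap_inclusion S ρ N hN _ 2 (Or.inr rfl), hx]
    have hxz' : (x' : ρ.H 2) = Hmap (ρ.subrepresentation (N m) (hN m)) ρ (N m).subtypeL (fun _ _ ↦ rfl) 2 z' := by
      rw [hz', Hmap_subtype_Hmap_inclusion S ρ N hN _ 2 (Or.inr rfl), hx']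
    have ex : x = ⟨_, Hmap_subtype_mem_sha2 hN hzS⟩ := Subtype.ext hxz
    have ex' : x' = ⟨_, Hmap_subtype_mem_sha2 hN hz'S⟩ := Subtype.ext hxz'
    have exx : x + x' = ⟨Hmap (ρ.subrepresentation (N m) (hN m)) ρ (N m).subtypeL (fun _ _ ↦ rfl) 2 (z + z'),
        Hmap_subtype_mem_sha2 hN (Submodule.add_mem _ hzS hz'S)⟩ :=
      Subtype.ext (by
        show (x : ρ.H 2) + x' = Hmap (ρ.subrepresentation (N m) (hN m)) ρ (N m).subtypeL
          (fun _ _ ↦ rfl) 2 (z + z')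
        rw [map_add, hxz, hxz'])
    rw [exx, ex, ex', shaFunctionalFun_Hmap hT hex y hy (z + z') (Submodule.add_mem _ hzS hz'S),
      shaFunctionalFun_Hmap hT hex y hy z hzS, shaFunctionalFun_Hmap hT hex y hy z' hz'S,
      ← AddMonoidHom.add_apply, ← map_add]
    rfl

/-- Unfolding `shaFunctional`. [cite: Greenberg2010, §2.1 (6) p. 7] -/
theorem shaFunctional_apply [Finite (SigmaPlace S)] (hT : IsShaDualityTower (E := E) hmono Sh1 b)
    (hex : ∀ d : D, ∃ k, d ∈ N k) (y : continuousCohomology 1 E.dualSystem.limitRep.toTopRep)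
    (hy : ∀ k, cohomologyMap (E.dualSystem.projHom k) 1 y ∈ Sh1 k) (x : ↥(sha2 S ρ)) :
    shaFunctional hN E b hT hex y hy x = shaFunctionalFun hN E b hmono hex y hy x := rfl

/-! ### §3. Injectivity and `Λ`-balance -/

/-- **`Ψ(y) = 0 → y = 0`**: right non-degeneracy of every `b k` (D-a) kills every component `y_k`, and
`H¹_cont(Γ_K, T*) → lim_k H¹(Γ_K, Hom(D_k, μ_{p^k}))` is injective. [cite: Greenberg2010, §2.1 (6) p. 7]
[cite: MilneADT2006, Ch. I, Thm. 4.10(a)] -/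
theorem eq_zero_of_shaFunctional_eq_zero [NeZero p] [Finite (SigmaPlace S)] (hT : IsShaDualityTower (E := E) hmono Sh1 b)
    (hDa : ∀ k (z : ↥(Sh1 k)), (∀ x, b k x z = 0) → z = 0)
    (hex : ∀ d : D, ∃ k, d ∈ N k) (y : continuousCohomology 1 E.dualSystem.limitRep.toTopRep)
    (hy : ∀ k, cohomologyMap (E.dualSystem.projHom k) 1 y ∈ Sh1 k)
    (h0 : shaFunctional hN E b hT hex y hy = 0) : y = 0 := by
  have hk : ∀ k, cohomologyMap (E.dualSystem.projHom k) 1 y = 0 := fun k => by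
    have hz := hDa k ⟨_, hy k⟩ fun x => by
      rw [← shaFunctionalFun_Hmap hT hex y hy x.1 x.2, ← shaFunctional_apply hT, h0]
      rfl
    exact congrArg Subtype.val hz
  exact E.dualSystem.toCohomologyLimit₁_injective E.chain (fun k => E.finite_layerDual k)
    ((Subtype.ext (funext hk)).trans (map_zero _).symm)

/-- **`Λ`-balance `Ψ(r̂ y)(x) = Ψ(y)(r x)`** ((D-b₂) at a level of `x`, with `(r̂ y)_k = r̂_k y_k`, the
tree's `cohomologyMap_projHom_dualEndHom`). [cite: Greenberg2010, §2.1 (6) p. 7] -/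
theorem shaFunctional_dualEndHom [Finite (SigmaPlace S)] (hT : IsShaDualityTower (E := E) hmono Sh1 b)
    (hΛ : ∀ (r : Λ) (k : ℕ), ∀ d ∈ E.N k, r • d ∈ E.N k)
    (hend : ∀ (r : Λ) k (z : ↥(Sh1 k)),
      cohomologyMap (E.layerDualEndHom (DistribSMul.toAddMonoidHom D r) (hΛ r)
        (smul_toGaloisModule_apply r) k) 1 (z : galoisCohomology (E.layerDualRep k) 1) ∈ Sh1 k)
    (hDb₂ : ∀ (r : Λ) k (x : ↥(sha2 S (ρ.subrepresentation (N k) (hN k)))) (z : ↥(Sh1 k)),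
      b k ⟨r • x.1, Submodule.smul_mem _ r x.2⟩ z = b k x ⟨_, hend r k z⟩)
    (hex : ∀ d : D, ∃ k, d ∈ N k) (r : Λ) (y : continuousCohomology 1 E.dualSystem.limitRep.toTopRep)
    (hy : ∀ k, cohomologyMap (E.dualSystem.projHom k) 1 y ∈ Sh1 k)
    (hy' : ∀ k, cohomologyMap (E.dualSystem.projHom k) 1
      (cohomologyMap (E.dualEndHom (DistribSMul.toAddMonoidHom D r) (hΛ r) (smul_toGaloisModule_apply r)) 1 y)
        ∈ Sh1 k)
    (x : ↥(sha2 S ρ)) :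
    shaFunctional hN E b hT hex _ hy' x = shaFunctional hN E b hT hex y hy ⟨r • x.1, Submodule.smul_mem _ r x.2⟩ := by
  obtain ⟨k, xk, hxk, hx⟩ := exists_level_sha2_lift S ρ N hN hmono hex x.1 x.2
  have ex : x = ⟨_, Hmap_subtype_mem_sha2 hN hxk⟩ := Subtype.ext hx.symm
  have erx : (⟨r • x.1, Submodule.smul_mem _ r x.2⟩ : ↥(sha2 S ρ)) =
      ⟨Hmap (ρ.subrepresentation (N k) (hN k)) ρ (N k).subtypeL (fun _ _ ↦ rfl) 2 (r • xk),
        Hmap_subtype_mem_sha2 hN (Submodule.smul_mem _ r hxk)⟩ :=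
    Subtype.ext (by
      show r • (x : ρ.H 2) = Hmap (ρ.subrepresentation (N k) (hN k)) ρ (N k).subtypeL
        (fun _ _ ↦ rfl) 2 (r • xk)
      rw [map_smul, hx])
  rw [erx, ex, shaFunctional_apply, shaFunctional_apply, shaFunctionalFun_Hmap hT hex _ hy' xk hxk,
    shaFunctionalFun_Hmap hT hex y hy (r • xk) (Submodule.smul_mem _ r hxk), hDb₂ r k ⟨xk, hxk⟩]
  congr 1
  exact Subtype.ext (E.cohomologyMap_projHom_dualEndHom _ (hΛ r) (smul_toGaloisModule_apply r) k 1 y)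

/-! ### §4. (γ): `LEO` makes every `y ∈ Ш¹(K, Σ, T*)` `Λ`-torsion -/

/-- The Pontryagin dual of `Ш²(K, Σ, 𝐃)` with its natural `Λ`-action is a dual datum in the dictionary's
sense. [cite: Greenberg2016Selmer, §1 p. 2 L17–35] -/
theorem isDualPairing_characterModule_sha2 :
    IsDualPairing Λ ↥(sha2 S ρ) (AddMonoidHom.id (CharacterModule ↥(sha2 S ρ))) :=
  ⟨bijective_id, fun _ _ _ => rfl⟩

/-- **(γ) of Greenberg 2010 Prop. 3.2.1**: if `Ш²(K, Σ, 𝐃)` is cotorsion (`LEO`), then every class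
`y ∈ H¹_cont(Γ_K, T*)` whose level components lie in the `Sh1 k` (i.e. `y ∈ Ш¹(K, Σ, T*)`) is killed by
`H¹(r̂)` for some non-zero-divisor `r ∈ Λ` — GRANTED the tower of restricted Ш-dualities (`hT`, (D-a)
`hDa`, (D-b₂) `hDb₂`, stabilities `hend`). [cite: Greenberg2010, proof of Prop. 3.2.1 (p. 15 L19–21)]
[cite: Greenberg2010, §2.1 (6) p. 7] -/
theorem exists_nonZeroDivisor_dualEndHom_eq_zero_of_LEO [NeZero p] [Finite (SigmaPlace S)]
    (hT : IsShaDualityTower (E := E) hmono Sh1 b)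
    (hDa : ∀ k (z : ↥(Sh1 k)), (∀ x, b k x z = 0) → z = 0)
    (hΛ : ∀ (r : Λ) (k : ℕ), ∀ d ∈ E.N k, r • d ∈ E.N k)
    (hend : ∀ (r : Λ) k (z : ↥(Sh1 k)),
      cohomologyMap (E.layerDualEndHom (DistribSMul.toAddMonoidHom D r) (hΛ r)
        (smul_toGaloisModule_apply r) k) 1 (z : galoisCohomology (E.layerDualRep k) 1) ∈ Sh1 k)
    (hDb₂ : ∀ (r : Λ) k (x : ↥(sha2 S (ρ.subrepresentation (N k) (hN k)))) (z : ↥(Sh1 k)),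
      b k ⟨r • x.1, Submodule.smul_mem _ r x.2⟩ z = b k x ⟨_, hend r k z⟩)
    (hex : ∀ d : D, ∃ k, d ∈ N k) (hLEO : LEO S ρ)
    (y : continuousCohomology 1 E.dualSystem.limitRep.toTopRep)
    (hy : ∀ k, cohomologyMap (E.dualSystem.projHom k) 1 y ∈ Sh1 k) :
    ∃ r : Λ, r ∈ nonZeroDivisors Λ ∧
      cohomologyMap (E.dualEndHom (DistribSMul.toAddMonoidHom D r) (hΛ r) (smul_toGaloisModule_apply r)) 1 y
        = 0 := by
  have htors := hLEO (CharacterModule ↥(sha2 S ρ)) (AddMonoidHom.id _) isDualPairing_characterModule_sha2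
  obtain ⟨⟨r, hr⟩, hrf⟩ := @htors (shaFunctional hN E b hT hex y hy)
  refine ⟨r, hr, ?_⟩
  -- components of `r̂ y` lie in the `Sh1 k`
  have hy' : ∀ k, cohomologyMap (E.dualSystem.projHom k) 1
      (cohomologyMap (E.dualEndHom (DistribSMul.toAddMonoidHom D r) (hΛ r) (smul_toGaloisModule_apply r)) 1 y)
        ∈ Sh1 k := fun k => by
    rw [E.cohomologyMap_projHom_dualEndHom _ (hΛ r) (smul_toGaloisModule_apply r) k 1 y]
    exact hend r k ⟨_, hy k⟩
  refine eq_zero_of_shaFunctional_eq_zero hT hDa hex _ hy' ?_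
  refine AddMonoidHom.ext fun x => ?_
  refine (shaFunctional_dualEndHom hT hΛ hend hDb₂ hex r y hy hy' x).trans ?_
  have h := DFunLike.congr_fun hrf x
  rw [Submonoid.mk_smul, CharacterModule.smul_apply] at h
  exact h

end Literature.NumberTheory.IwasawaTheory.Greenberg2016
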